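import Summits.Ventures.HodgeRepro2.T5SU11JacobiKPartMeasure
import Summits.Ventures.HodgeRepro2.T5SU11JacobiTransform

/-!
# The total mass of the explicit model's orbit law is the Jacobi transform: `(poincare.withDensity F_{k,λ}) 𝔻 = m̂_k(λ)`,
so `kProj_* P_{k,λ} = m̂_k(λ) · dk` and the normalised law of the pair is `(orbit law / m̂_k(λ)) ⊗ dk`

The orbit law `poincare.withDensity F_{k,λ}` of `T5SU11JacobiKPartMeasure` has total mass `∫_𝔻 F_{k,λ} dpoincare
= ∫_G m_k φ_λ dν = m̂_k(λ)` (`T5SU11JacobiKPartLaw.integral_orbit_mul_jacobi` with `Φ = 1`; the density is integrable on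
the ray, `T5SU11JacobiTransform.integrable_orbit_rpow_mul_sph`), so

  **`(poincare.withDensity F_{k,λ}) univ = ENNReal.ofReal (m̂_k(λ))`**   (`jacobiDiscDensity_mass`),
  **`kProj_* P_{k,λ} = ENNReal.ofReal (m̂_k(λ)) • dk`**   (`map_kProj_jacobi_eq_smul`),

for every `(k, λ)` on the ray. Nothing is claimed about (N).

Blind lane: Mathlib + the HodgeRepro2 prefix only; no sorry; axioms ⊆ {propext, Classical.choice,
Quot.sound}.
-/

namespace Summit.Ventures.HodgeRepro2.T5SU11JacobiKPartMass

open MeasureTheory MeasureTheory.Measure Metric Set Filter Topology Complex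
open T5PoincareDensity T5PoincareMeasure T5SU11Unimodular T5SU11Fibration T5SU11FibrationHaar T5SU11Cartan
  T5HaarCircle T5BergmanCoefficient T5SU11KProjection T5SU11OrbitMeasure T5SU11SphericalFunction
  T5SU11SphericalBounds T5SU11SphericalContinuous T5SU11JacobiWeight T5SU11KFiniteMajorantPow T5SU11JacobiTransform
  T5SU11JacobiKPartLaw T5SU11JacobiKPartMeasure
open scoped ENNReal Real

section measure

variable [MeasurableSpace Circle] [BorelSpace Circle]

/-- `F_{k,λ}` (real-valued) is integrable on the disc for the Poincaré measure, on the ray. -/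
theorem integrable_jacobi_disc_density {k lam : ℝ} (hk : 1 < k) (h1 : lam < k) (h2 : 2 < k + lam) :
    Integrable (fun z : ℂ => (1 - ‖z‖ ^ 2) ^ (k / 2) * sph lam (sec z)) poincare := by
  have hmap : Measure.map orbit (nu haarCircle) = poincare := by
    rw [map_orbit_nu, haarCircle_univ, one_smul]
  rw [← hmap, integrable_map_measure (measurable_jacobi_disc_density k lam).aestronglyMeasurable
    continuous_orbit.measurable.aemeasurable]
  refine (integrable_orbit_rpow_mul_sph hk h1 h2).congr (Filter.Eventually.of_forall fun g => ?_)
  simp only [Function.comp_apply]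
  exact (jacobi_density_eq_orbit k lam g)

/-- **The total mass of the orbit law is the Jacobi transform**: on the ray,
`(poincare.withDensity F_{k,λ}) univ = ENNReal.ofReal (m̂_k(λ))`. -/
theorem jacobiDiscDensity_mass {k lam : ℝ} (hk : 1 < k) (h1 : lam < k) (h2 : 2 < k + lam) :
    (poincare.withDensity (jacobiDiscDensity k lam)) Set.univ
      = ENNReal.ofReal (∫ g, (1 - ‖orbit g‖ ^ 2) ^ (k / 2) * sph lam g ∂(nu haarCircle)) := by
  have hae : ∀ᵐ z ∂poincare, z ∈ ball (0 : ℂ) 1 := by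
    rw [ae_iff]
    exact poincare_compl_ball
  have hF0 : ∀ᵐ z ∂poincare, 0 ≤ (1 - ‖z‖ ^ 2) ^ (k / 2) * sph lam (sec z) := by
    filter_upwards [hae] with z hz
    rw [mem_ball_zero_iff] at hz
    exact mul_nonneg (Real.rpow_nonneg (by nlinarith [norm_nonneg z] : (0 : ℝ) ≤ 1 - ‖z‖ ^ 2) _) (sph_pos lam _).le
  rw [withDensity_apply _ MeasurableSet.univ, Measure.restrict_univ]
  unfold jacobiDiscDensity
  rw [← ofReal_integral_eq_lintegral_ofReal (integrable_jacobi_disc_density hk h1 h2) hF0]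
  congr 1
  have h := integral_orbit_mul_jacobi haarCircle k lam (Φ := fun _ => (1 : ℝ)) measurable_const
  simp only [one_mul, haarCircle_univ, ENNReal.toReal_one, mul_one] at h
  exact h.symm

/-- **`kProj_* P_{k,λ} = m̂_k(λ) · dk`** on the ray. -/
theorem map_kProj_jacobi_eq_smul {k lam : ℝ} (hk : 1 < k) (h1 : lam < k) (h2 : 2 < k + lam) :
    Measure.map kProj
        ((nu haarCircle).withDensity (fun g => ENNReal.ofReal ((1 - ‖orbit g‖ ^ 2) ^ (k / 2) * sph lam g)))
      = ENNReal.ofReal (∫ g, (1 - ‖orbit g‖ ^ 2) ^ (k / 2) * sph lam g ∂(nu haarCircle)) • haarCircle := by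
  rw [map_kProj_jacobi, jacobiDiscDensity_mass hk h1 h2]

end measure

end Summit.Ventures.HodgeRepro2.T5SU11JacobiKPartMass
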